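import Summits.BirchSwinnertonDyer.BirchSwinnertonDyer.Theorems.ManinLocalTwoThreeGammaOneKatoRoad
import Summits.BirchSwinnertonDyer.BirchSwinnertonDyer.Theorems.ManinLocalTwoThreeGammaOneWitness
import Summits.BirchSwinnertonDyer.BirchSwinnertonDyer.Theorems.ManinLocalTwoThreeShimuraLedgerIrreducible
import Summits.BirchSwinnertonDyer.Rank1Residual.ManinAdditive.TowerUnitTwist
import Literature.NumberTheory.EllipticCurves.KatoAdditiveTwistedValueNeronIntegralityThreeKPForms
import Literature.NumberTheory.EllipticCurves.Rank1Residual.GVParityTwistTransportProofs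
import HarnessLib

/-!
# THE Γ₁ / X₁(N)-OPTIMAL KATO ROAD AT `p = 3`: the lever `KatoFactThreeAt V D₁.f ⟹ 3 ∤ c₁`, and the IRREDUCIBLE locus of C3 through the
# X₁(N)-optimal curve WITHOUT the nine-shift equaliser chain (route `ManinLocalTwoThree`, cell bsd-f2-manin; crux C3 `ManinPrimeToThreeAtNine`
# stmt-BirchSwinnertonDyer-22968; LEAD seat p1 gen 13 — the `p = 3` twin of `…GammaOneKatoRoad.lean` §3 and `…ManinOddByLocus.lean` §1)

THE POINT.  es's Γ₁ Kato road was landed at `p = 2` (`GammaOneKatoRoad.not_two_dvd_maninConstant₁_of_katoFact_of_witness`, lead p1 g12) and its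
WITNESS half at both primes (`exists_twoAdicGammaOneWitness`, `exists_threeAdicGammaOneWitness`, p2 g12).  This file ports the LEVER to `p = 3`:
for an OPTIMAL `X₁(N)`-datum `D₁` of a globally minimal `V` additive at `3`, `KatoFactThreeAt V D₁.f` (the body of F₃ / F-es-18♭K at `V`; only its
EVEN-character half is used, the witness being even) and the 3-adic Γ₁ witness give `3 ∤ c₁` — the same bookkeeping as at `2`: `Ω(V) = c₁·j·(2 re y)`,
`j = ±1`, `ϖ = 1/(c₁ j k′)`, and `3 ∣ c₁` would make `s·r/3` an algebraic integer.  CONSEQUENCES: `not_three_dvd_maninConstant₁_of_katoFactThreeAt`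
(at `9 ∣ N`, additivity by `additive_of_sq_dvd_level`; the witness by p2's theorem — so es's E-es-110₃ `KatoNeronIntegralThreeGamma1Optimal` gives
`3 ∤ c₁` for every optimal `X₁(N)`-datum with `9 ∣ N`, `forall_not_three_dvd_maninConstant₁_of_katoNeronIntegralThreeGamma1Optimal`), and the
IRREDUCIBLE LOCUS OF C3 through the `X₁(N)`-optimal curve: `3 ∤ c₀` from `KatoFactThreeAt` at an optimal `X₁`-curve of the class + Ling–Oesterlé/Ribet
`|c₀| = |c₁|` (`natAbs_maninConstant₀_eq_natAbs_maninConstant₁_of_sq_dvd_of_hasIrreducibleModPGaloisRep` at `p = 3`), hence from F₃ (polar reading;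
`katoFactThreeAt_of_polar`, irreducibility transported along the isogeny) and Stevens' datum — **a second proof of the irreducible case of C3 that does
not pass through the Kato-SHIFT lever at `3` / the nine-shift equaliser chain** (`katoManinPrimeToThree_of_polar_of_exists_gamma1`; with v18's KP stub
via `polar_of_kp`).

HONEST FRAMING.  CONDITIONAL on statement-only facts (F₃ / F₃♮, hex) where stated; E-es-110₃ is an OPEN law.  C3, Manin's conjecture and BSD are
NOT proved.  No definitions, no sorry, axioms standard.
-/

set_option autoImplicit false
-- lint-debt: the directory name repeats the summit name (sibling precedent `ManinLocalTwoThreeGammaOneKatoRoad.lean`)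
set_option linter.dupNamespace false

noncomputable section

open scoped Classical MatrixGroups ModularForm
open CongruenceSubgroup Complex WeierstrassCurve Literature.NumberTheory.EllipticCurves
  Literature.NumberTheory.EllipticCurves.ModularForms
  Summit.BirchSwinnertonDyer.Rank1Residual.ManinAdditive
  Summit.BirchSwinnertonDyer.Rank1Residual.ManinAdditive.KatoCurve

namespace Summit.BirchSwinnertonDyer.BirchSwinnertonDyer.Theorems.ManinLocalTwoThree

open GammaOneKatoRoad

/-! ## §1 THE LEVER at `p = 3`: `KatoFactThreeAt` ∧ 3-adic Γ₁-witness (even) ∧ optimality ⟹ `3 ∤ c₁` -/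

/-- **THE Γ₁ LEVER at `p = 3`** (port of `GammaOneKatoRoad.not_two_dvd_maninConstant₁_of_katoFact_of_witness`): Kato–Néron integrality
`KatoFactThreeAt V D₁.f` at a globally minimal `V` additive at `3`, an EVEN primitive `χ` (`(m, 3N) = 1`, `χ ≠ 1`, `3 ∤ ord χ`, `χ(3) ∉ {±1}`) with a
Γ₁-unit twist at `3` (`s·r/3 ∉ ℤ̄` for all `s` prime to `3`, `r` the twisted sum over `2 re y`, `y` an `re`-generator of `Λ₁(f)`), and optimality
`Λ_V = c₁Λ₁(f)` give `3 ∤ c₁`. [cite: Kato2004Asterisque, Thm. 12.6 (2) (p. 222) (shape of the integrality input)] [cite: Stevens1989, §2 (Λ₁(f))] -/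
theorem not_three_dvd_maninConstant₁_of_katoFactThreeAt_of_witness
    (V : WeierstrassCurve ℚ) [V.IsElliptic] [V.IsGloballyMinimal] {N : ℕ} [NeZero N]
    (D₁ : Gamma1ParametrizationData V N) (hopt : D₁.IsOptimal)
    (hF : KatoFactThreeAt V D₁.f) (hg : ¬ V.HasGoodReductionAtPrime 3) (hmu : ¬ V.HasMultiplicativeReductionAtPrime 3)
    {m : ℕ} [NeZero m] (χ : DirichletCharacter ℂ m) (hcop : m.Coprime (3 * N)) (hprim : χ.IsPrimitive) (hne : χ ≠ 1)
    (hord : ¬ 3 ∣ orderOf χ) (h3a : χ (3 : ZMod m) ≠ 1) (h3b : χ (3 : ZMod m) ≠ -1) (heven : χ.Even)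
    (r y : ℂ) (hy : y ∈ periodLatticeGamma1 D₁.f) (hyre : y.re ≠ 0)
    (hgen : ∀ x ∈ periodLatticeGamma1 D₁.f, ∃ j : ℤ, x.re = j * y.re)
    (hsum : (∏ ℓ ∈ N.primeFactors with ¬ ℓ ^ 2 ∣ N,
        (((ℓ : ℂ) - (V.LFunction ℓ : ℂ) * χ (ℓ : ZMod m)) *
          ((ℓ : ℂ) - (V.LFunction ℓ : ℂ) * (χ (ℓ : ZMod m))⁻¹))) *
        twistedSymbolSum D₁.f χ = r * ((2 * y.re : ℝ) : ℂ))
    (hunit : ∀ s : ℕ, ¬ 3 ∣ s → ¬ _root_.IsIntegral ℤ ((s : ℂ) * r / 3)) :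
    ¬ (3 : ℤ) ∣ D₁.maninConstant := by
  -- the Γ₀-plus period and `2 re y = k' Ω⁺_f`
  have hf : IsNewform0 D₁.f := D₁.isNewformOf.1
  have hQ : coeffField D₁.f = ⊥ := D₁.isNewformOf.coeffField_eq_bot
  have hpos : 0 < plusPeriod D₁.f := IsNewform0.plusPeriod_pos_holds hf hQ
  have hre : realPeriods D₁.f = AddSubgroup.zmultiples (plusPeriod D₁.f / 2) :=
    realPeriods_eq_zmultiples_of_plusPeriod_pos D₁.f hpos
  have hyΛ : y ∈ periodLattice D₁.f := periodLatticeGamma1_le_periodLattice D₁.f hy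
  have hyre' : y.re ∈ realPeriods D₁.f := by
    rw [realPeriods, AddSubgroup.mem_map]; exact ⟨y, hyΛ, rfl⟩
  rw [hre, AddSubgroup.mem_zmultiples_iff] at hyre'
  obtain ⟨k', hk'⟩ := hyre'
  rw [zsmul_eq_mul] at hk'
  -- `Ω(V) = c₁ j (2 re y)` and `c₁ (2 re y) = k Ω(V)`, so `j k = 1`
  obtain ⟨z, hz, hzre⟩ := Gamma1Period.exists_mem_lattice_re_eq_realPeriodRat_div_two D₁.L D₁.isNeronLattice
  obtain ⟨w, hw, hzw⟩ := hopt z hz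
  obtain ⟨j, hj⟩ := hgen w hw
  have h1 : V.realPeriodRat = (D₁.c : ℝ) * j * (2 * y.re) := by
    have h := congrArg Complex.re hzw
    rw [hzre, Complex.mul_re, Complex.intCast_re, Complex.intCast_im, zero_mul, sub_zero, hj] at h
    linarith
  have hcy : (D₁.c : ℂ) * y ∈ D₁.L.lattice := D₁.smul_periodLatticeGamma1_le y hy
  obtain ⟨k, hk⟩ := Gamma1Period.exists_re_eq_int_mul_realPeriodRat_div_two D₁.L D₁.isNeronLattice hcy
  rw [Complex.mul_re, Complex.intCast_re, Complex.intCast_im, zero_mul, sub_zero] at hk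
  have hΩpos : 0 < V.realPeriodRat := KatoCurve.realPeriodRat_pos V
  have hjk : (j : ℝ) * k = 1 := by
    have h2 : (D₁.c : ℝ) * (2 * y.re) = k * V.realPeriodRat := by linarith
    have h3 : V.realPeriodRat = (j : ℝ) * k * V.realPeriodRat := by
      calc V.realPeriodRat = (D₁.c : ℝ) * j * (2 * y.re) := h1
        _ = j * ((D₁.c : ℝ) * (2 * y.re)) := by ring
        _ = j * (k * V.realPeriodRat) := by rw [h2]
        _ = (j : ℝ) * k * V.realPeriodRat := by ring
    have := mul_right_cancel₀ hΩpos.ne' (h3.symm.trans (one_mul _).symm)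
    linarith
  have hjkZ : j * k = 1 := by exact_mod_cast hjk
  have hj1 : j = 1 ∨ j = -1 := Int.eq_one_or_neg_one_of_mul_eq_one hjkZ
  -- the rational normalisation `ϖ Ω(V) = Ω⁺_f`
  have hc0 : D₁.c ≠ 0 := D₁.maninConstant_ne_zero
  have hk'0 : (k' : ℝ) ≠ 0 := by
    intro h; apply hyre; rw [← hk', h, zero_mul]
  have hΩV : V.realPeriodRat = (D₁.c : ℝ) * j * k' * plusPeriod D₁.f := by
    rw [h1, ← hk']; ring
  set ϖ : ℚ := 1 / ((D₁.c : ℚ) * j * k') with hϖ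
  have hϖΩ : (ϖ : ℝ) * V.realPeriodRat = plusPeriod D₁.f := by
    have hc0' : (D₁.c : ℝ) ≠ 0 := by exact_mod_cast hc0
    have hj0 : (j : ℝ) ≠ 0 := by rcases hj1 with rfl | rfl <;> norm_num
    rw [hΩV, hϖ]; push_cast
    field_simp
  -- the Γ₀-normalised value `r₀ = r k'`
  have hsum₀ : (∏ ℓ ∈ N.primeFactors with ¬ ℓ ^ 2 ∣ N,
        (((ℓ : ℂ) - (V.LFunction ℓ : ℂ) * χ (ℓ : ZMod m)) *
          ((ℓ : ℂ) - (V.LFunction ℓ : ℂ) * (χ (ℓ : ZMod m))⁻¹))) *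
        twistedSymbolSum D₁.f χ = (r * k') * (plusPeriod D₁.f : ℂ) := by
    rw [hsum]
    have : (((2 * y.re : ℝ)) : ℂ) = (k' : ℂ) * (plusPeriod D₁.f : ℂ) := by
      rw [← hk']; push_cast; ring
    rw [this]; ring
  obtain ⟨s, hs, hint⟩ := (hF D₁.isNewformOf hg hmu m hcop χ hprim hne hord h3a h3b ϖ (r * k')).1 heven hϖΩ hsum₀
  -- `s ϖ r k' = s r / (c₁ j)`; if `3 ∣ c₁ = 3c'` then `s r / 3 = (c' j) · (s ϖ r k')` is integral, contradiction
  rintro ⟨c', hc'⟩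
  have hcc : D₁.c = 3 * c' := hc'
  apply hunit s hs
  have hc'0 : (c' : ℂ) ≠ 0 := by
    have : (3 * c' : ℤ) ≠ 0 := hcc ▸ hc0
    exact_mod_cast (mul_ne_zero_iff.mp this).2
  have hj0 : (j : ℂ) ≠ 0 := by rcases hj1 with rfl | rfl <;> norm_num
  have hk'C : (k' : ℂ) ≠ 0 := by exact_mod_cast hk'0
  have key : (s : ℂ) * r / 3 = ((c' * j : ℤ) : ℂ) * ((s : ℂ) * (ϖ : ℂ) * (r * k')) := by
    rw [hϖ, hcc]; push_cast
    field_simp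
  rw [key]
  exact (isIntegral_algebraMap (R := ℤ) (A := ℂ) (x := c' * j)).mul hint

/-! ## §2 `3 ∤ c₁` from `KatoFactThreeAt` at the optimal X₁(N)-curve (`9 ∣ N`; the witness is p2's theorem) -/

/-- **`3 ∤ c₁` at level `N`, `9 ∣ N`, from Kato–Néron integrality at the `X₁(N)`-optimal curve** (§1 + p2's `exists_threeAdicGammaOneWitness` +
`additive_of_sq_dvd_level` at `3`). [cite: Kato2004Asterisque, Thm. 12.6 (2) (p. 222)] -/
theorem not_three_dvd_maninConstant₁_of_katoFactThreeAt
    (V : WeierstrassCurve ℚ) [V.IsElliptic] [V.IsGloballyMinimal] {N : ℕ} [NeZero N]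
    (D₁ : Gamma1ParametrizationData V N) (hopt : D₁.IsOptimal) (h9 : 3 ^ 2 ∣ N) (hK : KatoFactThreeAt V D₁.f) :
    ¬ (3 : ℤ) ∣ D₁.maninConstant := by
  haveI : Fact (Nat.Prime 3) := ⟨Nat.prime_three⟩
  obtain ⟨hg, hmu⟩ := additive_of_sq_dvd_level 3 V D₁.f D₁.isNewformOf h9
  obtain ⟨m, hm0, χ, hcop, hprim, hne, hord, h3a, h3b, heven, r, y, hy, hyre, hgen, hsum, hunit⟩ :=
    exists_threeAdicGammaOneWitness V D₁.f D₁.isNewformOf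
  exact not_three_dvd_maninConstant₁_of_katoFactThreeAt_of_witness V D₁ hopt hK hg hmu χ hcop hprim hne hord h3a h3b heven
    r y hy hyre hgen hsum hunit

/-- **es's E-es-110₃ `KatoNeronIntegralThreeGamma1Optimal` ⟹ `3 ∤ c₁` for every optimal `X₁(N)`-datum with `9 ∣ N`** (the `p = 3` twin of
`gammaOneOddAtFour_of`, conclusion stated inline). [cite: Kato2004Asterisque, Thm. 12.6 (2) (p. 222) (shape)] -/
theorem forall_not_three_dvd_maninConstant₁_of_katoNeronIntegralThreeGamma1Optimal (h110 : KatoNeronIntegralThreeGamma1Optimal) :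
    ∀ (V : WeierstrassCurve ℚ) [V.IsElliptic] [V.IsGloballyMinimal] {N : ℕ} [NeZero N]
      (D₁ : Gamma1ParametrizationData V N), D₁.IsOptimal → 3 ^ 2 ∣ N → ¬ (3 : ℤ) ∣ D₁.maninConstant :=
  fun V _ _ _N _ D₁ hopt h9 ↦ not_three_dvd_maninConstant₁_of_katoFactThreeAt V D₁ hopt h9 (h110 V D₁ hopt)

/-! ## §3 The IRREDUCIBLE locus of C3 through the X₁(N)-optimal curve (no nine-shift chain) -/

/-- **Irreducible `W₀[3]`, `9 ∣ N`: `3 ∤ c₀` from Kato–Néron integrality at an optimal `X₁(N)`-curve of the class** — `3 ∤ c₁` (§2) and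
`|c₀| = |c₁|` (Ling–Oesterlé + Ribet: `Λ₁(f) = Λ₀(f)` on the `W[3]`-irreducible locus at `9 ∣ N`; NO printed fact).
[cite: LingOesterle1991, Thm. 6] [cite: Ribet1988Shimura, Thm. 1 and §3] -/
theorem not_three_dvd_maninConstant_of_katoFactThreeAt₁_of_irreducible
    (W₁ W₀ : WeierstrassCurve ℚ) [W₁.IsElliptic] [W₁.IsGloballyMinimal] [W₀.IsElliptic] [W₀.IsGloballyMinimal]
    {N : ℕ} [NeZero N] (D₁ : Gamma1ParametrizationData W₁ N) (D₀ : ModularParametrizationData W₀ N)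
    (hiso : IsIsogenous W₁ W₀) (hD₁ : D₁.IsOptimal) (hopt : ∀ z ∈ D₀.L.lattice, ∃ w ∈ periodLattice D₀.f, z = D₀.c * w)
    (h9 : 3 ^ 2 ∣ N) (hirr : W₀.HasIrreducibleModPGaloisRep 3) (hK : KatoFactThreeAt W₁ D₁.f) :
    ¬ (3 : ℤ) ∣ D₀.maninConstant := by
  have hodd := not_three_dvd_maninConstant₁_of_katoFactThreeAt W₁ D₁ hD₁ h9 hK
  have heq := natAbs_maninConstant₀_eq_natAbs_maninConstant₁_of_sq_dvd_of_hasIrreducibleModPGaloisRep D₁ D₀ hiso hD₁ hopt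
    Nat.prime_three h9 hirr
  intro hdvd
  apply hodd
  have : (3 : ℤ).natAbs ∣ D₁.maninConstant.natAbs := by
    rw [← heq]; exact Int.natAbs_dvd_natAbs.mpr hdvd
  exact Int.natAbs_dvd_natAbs.mp this

/-- **The irreducible case of C3 on one class from F₃ (polar reading) and an optimal `X₁(N)`-datum — WITHOUT the Kato-shift lever at `3`**:
F₃ gives `KatoFactThreeAt` at the irreducible `W₁` (`katoFactThreeAt_of_polar`; irreducibility of `W₁[3]` from that of `W₀[3]` along the isogeny),
then §3. [cite: Kato2004Asterisque, Thm. 12.6 (2) (p. 222) and remark after (12.8.1) (p. 223)] -/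
theorem not_three_dvd_maninConstant_of_polar_of_gamma1Datum_of_irreducible
    (hF : kato_neron_isIntegral_twistedSymbolSum_of_additive_three_polar)
    (W₁ W₀ : WeierstrassCurve ℚ) [W₁.IsElliptic] [W₁.IsGloballyMinimal] [W₀.IsElliptic] [W₀.IsGloballyMinimal]
    {N : ℕ} [NeZero N] (D₁ : Gamma1ParametrizationData W₁ N) (D₀ : ModularParametrizationData W₀ N)
    (hiso : IsIsogenous W₁ W₀) (hD₁ : D₁.IsOptimal) (hopt : ∀ z ∈ D₀.L.lattice, ∃ w ∈ periodLattice D₀.f, z = D₀.c * w)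
    (h9 : 3 ^ 2 ∣ N) (hirr : W₀.HasIrreducibleModPGaloisRep 3) : ¬ (3 : ℤ) ∣ D₀.maninConstant := by
  have hirr₁ : W₁.HasIrreducibleModPGaloisRep 3 := by
    by_contra h
    exact Literature.NumberTheory.EllipticCurves.Rank1Residual.not_hasIrreducibleModPGaloisRep_of_isIsogenous hiso h hirr
  exact not_three_dvd_maninConstant_of_katoFactThreeAt₁_of_irreducible W₁ W₀ D₁ D₀ hiso hD₁ hopt h9 hirr
    (katoFactThreeAt_of_polar hF W₁ D₁.f hirr₁)

/-- **C3 on the IRREDUCIBLE locus at `9 ∣ N` ⟸ F₃ (polar) ∧ the existence of Stevens' optimal `X₁(N)`-datum** — the Γ₁ road at `3`; compare the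
tree's Kato-shift lever at `3` (`…ManinPrimeToThreeAtNineKatoShiftLever`, nine-shift equaliser chain).  With v18's KP stub: `hF := polar_of_kp hKP`.
CONDITIONAL on two statement-only facts. [cite: Kato2004Asterisque, Thm. 12.6 (2) (p. 222)] [cite: Stevens1989, §2] -/
theorem katoManinPrimeToThree_of_polar_of_exists_gamma1 (hF : kato_neron_isIntegral_twistedSymbolSum_of_additive_three_polar)
    (hex : exists_optimal_gamma1ParametrizationData) :
    ∀ (W : WeierstrassCurve ℚ) [W.IsElliptic] [W.IsGloballyMinimal] {N : ℕ} [NeZero N]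
      (D : ModularParametrizationData W N),
      (∀ z ∈ D.L.lattice, ∃ w ∈ periodLattice D.f, z = D.c * w) → 3 ^ 2 ∣ N →
      W.HasIrreducibleModPGaloisRep 3 → ¬ (3 : ℤ) ∣ D.c := by
  intro W _ _ N _ D hopt h9 hirr
  obtain ⟨W₁, i₁, i₂, D₁, hiso, hD₁⟩ := hex W D hopt
  exact not_three_dvd_maninConstant_of_polar_of_gamma1Datum_of_irreducible hF W₁ W D₁ D hiso hD₁ hopt h9 hirr

/-- The same from v18's KP-form stub F₃♮ (`polar_of_kp`). [cite: KostersPannekoek2017, Thm. 1, §3.3.1 (KP form)] -/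
theorem katoManinPrimeToThree_of_kp_of_exists_gamma1 (hKP : kato_neron_isIntegral_twistedSymbolSum_of_additive_three_kp)
    (hex : exists_optimal_gamma1ParametrizationData) :
    ∀ (W : WeierstrassCurve ℚ) [W.IsElliptic] [W.IsGloballyMinimal] {N : ℕ} [NeZero N]
      (D : ModularParametrizationData W N),
      (∀ z ∈ D.L.lattice, ∃ w ∈ periodLattice D.f, z = D.c * w) → 3 ^ 2 ∣ N →
      W.HasIrreducibleModPGaloisRep 3 → ¬ (3 : ℤ) ∣ D.c :=
  katoManinPrimeToThree_of_polar_of_exists_gamma1 (polar_of_kp hKP) hex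

end Summit.BirchSwinnertonDyer.BirchSwinnertonDyer.Theorems.ManinLocalTwoThree

end
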